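import Summits.FinalStateConjecture.FinalStateConjecture.Theorems.PhotonSphereChannelsKerrDevDefs
import Literature.Geometry.Lorentzian.SpacetimeLocalConvergenceChartOrientation
import HarnessLib

/-!
# Route PhotonSphereChannels · crux `ChannelsResolveTameDevelopmentsR` (K2R, stmt-FinalStateConjecture-14075) — pushing ONE
# timelike vector through a pointed `Cᵏ_loc` limit (line `kerr-isolation-dichotomy`, lead c2; stub-worker S1, supports stub S1
# `stub_silentHullExtraction`: the orientation clause of an ANCHOR-oriented window chart; registered sub-goal
# `eventually_isTimelike_mfderiv_embed_apply`)

The orientation clause of `IsWindowChart` (`∂_{t*}` future-CAUSAL on the non-compact `W ∩ {r > 2M}`) does not survive the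
push through the comparison maps `φₙ` of a pointed limit without a timelike margin on a compact set
(`…RSilentHullDictionary.lean`, module docstring (T)). An orientation clause tested at ONE point — the anchor — against a
vector that is TIMELIKE there does survive, and this file supplies the two facts such a clause needs:

* `eventually_isTimelike_mfderiv_embed_apply` — a timelike vector `w` at a point `z` of the limit is sent by `dφₙ` to a
  timelike vector of `𝓢ₙ` for all large `n` (the `C⁰` part of `φₙ^* gₙ → g` at the single point `z`, read in the chart at
  `z`: `|gₙ(dφₙ w, dφₙ w) − g(w, w)| ≤ ‖devₙ(c z)‖ ‖dc w‖² → 0` by `Spacetime.abs_val_mfderiv_sub_val_le`);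
* `eventually_isTimelike_and_isFutureDirected_mfderiv_embed_comp_apply` — for a map `Ψ : E4 → 𝓢` smooth near `y` and a
  coordinate vector `V` with `dΨ_y(V)` timelike and future-directed, eventually `d(φₙ ∘ Ψ)_y(V)` is timelike AND
  future-directed (chain rule + the above + `LocalSubconvergence.eventually_isFutureDirected_mfderiv_comp_chart` on `{y}`).

The Literature file `SpacetimeLocalConvergenceTimeOrientation.lean` proves the timelike push only for the orienting field
`T` (`eventually_isTimelike_mfderiv_embed`); the present single-vector form is its pointwise variant.
References: Petersen 2006, Ch. 10 §3.2 [Petersen2006]; O'Neill 1983, Ch. 5, p. 145 [ONeill1983].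
-/

noncomputable section

-- the operator-norm instance on `E4 →L[ℝ] E4 →L[ℝ] ℝ` needs one more level of pending
-- instance problems than the default (as in `PhotonSphereChannelsKerrDevDefs.lean`)
set_option maxSynthPendingDepth 3
-- every `Summit.FinalStateConjecture.FinalStateConjecture.…` name repeats the summit = sub-problem segment (D-0017 layout)
set_option linter.dupNamespace false

open Set Filter Function TopologicalSpace Manifold Bundle
open scoped Topology Manifold ContDiff ENNReal NNReal

namespace Summit.FinalStateConjecture.FinalStateConjecture.Theorems

open Literature.Geometry.Lorentzian
open Summit.FinalStateConjecture.FinalStateConjecture.Theorems.TameHull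

/-- **Registered sub-goal `eventually_isTimelike_mfderiv_embed_apply`: a timelike vector stays timelike under the
comparison maps of a pointed `Cᵏ_loc` limit, eventually.** For `Dat : (𝓢ₙ, pₙ) ⇀ (𝓢, p)`, a point `z` of the limit and
a timelike `w ∈ T_z 𝓢`: for all large `n`, `dφₙ(w)` is timelike in `𝓢ₙ (Dat.sub n)` — with `μ = −g(w,w) > 0` and
`B = ‖dc_z w‖`, once `‖devₙ(c z)‖ < μ / (B² + 1)` (convergence clause on the compact `{c z}`) one has
`|gₙ(dφₙ w, dφₙ w) − g(w,w)| < μ`. [cite: Petersen2006, Ch. 10 §3.2] -/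
theorem eventually_isTimelike_mfderiv_embed_apply : ∀ {𝓢ₙ : ℕ → Spacetime.{0} 4} {pₙ : ∀ n, (𝓢ₙ n).carrier} {𝓢 : Spacetime.{0} 4} {p : 𝓢.carrier} {k : ℕ} (Dat : Spacetime.LocalSubconvergence 𝓢ₙ pₙ 𝓢 p k) (z : 𝓢.carrier) {w : TangentSpace (𝓡 4) z}, 𝓢.metric.IsTimelike w → ∀ᶠ n in atTop, (𝓢ₙ (Dat.sub n)).metric.IsTimelike (mfderiv (𝓡 4) (𝓡 4) (Dat.embed n) z w) := by
  intro 𝓢ₙ pₙ 𝓢 p k Dat z w hw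
  set c := chartAt E4 z with hc
  have hzs : z ∈ c.source := mem_chart_source E4 z
  set V : E4 := mfderiv (𝓡 4) 𝓘(ℝ, E4) c z w with hV
  have hμ : 0 < -𝓢.metric.val z w w := by
    have h : 𝓢.metric.val z w w < 0 := hw
    linarith
  have hδpos : 0 < -𝓢.metric.val z w w / (‖V‖ ^ 2 + 1) := div_pos hμ (by positivity)
  have hK : IsCompact ({c z} : Set E4) := isCompact_singleton
  have hKt : ({c z} : Set E4) ⊆ c.target := singleton_subset_iff.2 (mem_chart_target E4 z)
  have hE2 : ∀ᶠ n in atTop, supCkENorm {c z} k (Dat.coordDeviation n z) <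
      ENNReal.ofReal (-𝓢.metric.val z w w / (‖V‖ ^ 2 + 1)) :=
    (tendsto_order.1 (Dat.tendsto_supCkENorm_coordDeviation z hK hKt)).2 _ (ENNReal.ofReal_pos.2 hδpos)
  filter_upwards [Dat.eventually_mem_U z, hE2] with n hn1 hn2
  have hG : MDifferentiableAt (𝓡 4) (𝓡 4) (Dat.embed n) z :=
    ((Dat.contMDiffOn_embed n z hn1).contMDiffAt ((Dat.U n).isOpen.mem_nhds hn1)).mdifferentiableAt (by simp)
  have hdev : ‖Spacetime.chartDeviation (𝓢ₙ (Dat.sub n)) (Dat.embed n) z (c z)‖ <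
      -𝓢.metric.val z w w / (‖V‖ ^ 2 + 1) := by
    have hfin : supCkENorm {c z} k (Dat.coordDeviation n z) ≠ ⊤ := (hn2.trans ENNReal.ofReal_lt_top).ne
    have h0 := norm_iteratedFDeriv_le_toReal_supCkENorm (Nat.zero_le k) (mem_singleton (c z))
      (Dat.coordDeviation n z) hfin
    rw [norm_iteratedFDeriv_zero] at h0
    exact h0.trans_lt (ENNReal.toReal_lt_of_lt_ofReal hn2)
  have hd0 : 0 ≤ ‖Spacetime.chartDeviation (𝓢ₙ (Dat.sub n)) (Dat.embed n) z (c z)‖ := norm_nonneg _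
  have hTT := 𝓢.abs_val_mfderiv_sub_val_le hzs hG w w hV hV
  have bTT := Spacetime.LocalSubconvergence.mul_mul_lt_of_lt_div hd0 (norm_nonneg V) (norm_nonneg V) hμ le_rfl
    le_rfl hdev
  show (𝓢ₙ (Dat.sub n)).metric.val _ _ _ < 0
  have h1 := (abs_sub_lt_iff.1 (hTT.trans_lt bTT)).1
  linarith

/-- **The anchored orientation clause survives the push.** For `Ψ : E4 → 𝓢` of class `C^∞` on an open `O ∋ y` and a
coordinate vector `V` with `dΨ_y(V)` timelike and future-directed: for all large `n`, `d(φₙ ∘ Ψ)_y(V)` is timelike and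
future-directed in `𝓢ₙ (Dat.sub n)` (chain rule `d(φₙ ∘ Ψ)_y = dφₙ ∘ dΨ_y` once `Ψ y ∈ Dat.U n`, then
`eventually_isTimelike_mfderiv_embed_apply` and the Literature chart-orientation theorem
`LocalSubconvergence.eventually_isFutureDirected_mfderiv_comp_chart` on the compact set `{y}`, as in
`eventually_isFutureDirected_mfderiv_embed_comp_singleton` of `…RSilentHullDictionary.lean`). [cite: ONeill1983, Ch. 5, p. 145] -/
theorem eventually_isTimelike_and_isFutureDirected_mfderiv_embed_comp_apply {𝓢ₙ : ℕ → Spacetime.{0} 4}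
    {pₙ : ∀ n, (𝓢ₙ n).carrier} {𝓢 : Spacetime.{0} 4} {p : 𝓢.carrier} {k : ℕ}
    (Dat : Spacetime.LocalSubconvergence 𝓢ₙ pₙ 𝓢 p k) {Ψ : E4 → 𝓢.carrier} {O : Set E4} (hO : IsOpen O)
    (hΨ : ContMDiffOn 𝓘(ℝ, E4) (𝓡 4) ∞ Ψ O) {y : E4} (hy : y ∈ O) (V : E4)
    (htl : 𝓢.metric.IsTimelike (mfderiv 𝓘(ℝ, E4) (𝓡 4) Ψ y V))
    (hfut : 𝓢.timeOrientation.IsFutureDirected (mfderiv 𝓘(ℝ, E4) (𝓡 4) Ψ y V)) :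
    ∀ᶠ n in atTop, (𝓢ₙ (Dat.sub n)).metric.IsTimelike (mfderiv 𝓘(ℝ, E4) (𝓡 4) (Dat.embed n ∘ Ψ) y V) ∧
      (𝓢ₙ (Dat.sub n)).timeOrientation.IsFutureDirected (mfderiv 𝓘(ℝ, E4) (𝓡 4) (Dat.embed n ∘ Ψ) y V) := by
  have hΨd : MDifferentiableAt 𝓘(ℝ, E4) (𝓡 4) Ψ y :=
    ((hΨ _ hy).contMDiffAt (hO.mem_nhds hy)).mdifferentiableAt (by simp)
  -- the orientation half: the Literature chart-orientation theorem on the compact set `{y}`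
  have hfut' := Dat.eventually_isFutureDirected_mfderiv_comp_chart hO hΨ isCompact_singleton
    (singleton_subset_iff.2 hy) V (fun x hx ↦ by rw [mem_singleton_iff.1 hx]; exact hfut)
    fun x hx ↦ by rw [mem_singleton_iff.1 hx]; exact htl
  filter_upwards [eventually_isTimelike_mfderiv_embed_apply Dat (Ψ y) htl, hfut', Dat.eventually_mem_U (Ψ y)]
    with n htn hfn hUn
  have hGd : MDifferentiableAt (𝓡 4) (𝓡 4) (Dat.embed n) (Ψ y) :=
    ((Dat.contMDiffOn_embed n _ hUn).contMDiffAt ((Dat.U n).isOpen.mem_nhds hUn)).mdifferentiableAt (by simp)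
  refine ⟨?_, hfn y (mem_singleton y)⟩
  rw [mfderiv_comp y hGd hΨd]
  exact htn

end Summit.FinalStateConjecture.FinalStateConjecture.Theorems

end
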